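import Mathlib
import Summits.QuantumFields.QCD.Theorems.WilsonQuarkChessboardBackgroundSchwarzReflect

/-!
# Positivity of the hyperplane blocks (Montvay–Münster's `B > 0` for `6κ < 1`) (helper for `BackgroundSchwarz`)

On a diagonal `γ₀`-block of spins and at a fixed time, the rotated Wilson–Dirac operator is the
spin-blind spatial Wilson operator `B = (m+4)·1 - ½ Σ_k (H_k + H_kᴴ)` (Montvay–Münster (4.104),
(4.105), colour-gauged), where the hops `H_k` are isometries (a spatial translation followed by the
unitary link matrices).  Hence `Re ⟨v, B v⟩ ≥ (m + 1) ‖v‖²` and `B` is positive definite for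
`m > -1`, i.e. `6κ < 1` ((4.111)); this is the only place where the mass bound enters.  We prove it
for the direct sum of the two reflection hyperplanes at once (indexed by
`Fin 2 × (spatial site × colour × spin component)`), for an arbitrary `U(N)` background; the hop and
block matrices are local notations (no definitions are introduced).
-/

noncomputable section

namespace Summit.QuantumFields.QCD.Theorems.BackgroundSchwarz

open Matrix Complex Finset
open Literature.MathematicalPhysics Literature.MathematicalPhysics.QuantumLattice
  Literature.MathematicalPhysics.QuantumFieldTheory Literature.Probability.LatticeModels
open scoped ComplexOrder

variable {L N : ℕ} [NeZero L]

local notation "𝕌" => Matrix.unitaryGroup (Fin N) ℂ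
local notation "ρ₀" => Literature.MathematicalPhysics.QuantumLattice.unitaryFundamentalRep (Fin N) ℂ

set_option quotPrecheck false in
/-- The spatial hop in direction `k` inside the planes `τ c`:
`(c,xs,a,s; c',ys,b,s') ↦ [c = c'] [ys = xs + ê_k] [s = s'] ρ₀(W((τ c, xs), k))_{ab}`. -/
local notation "planeHop[" W ", " τ ", " k "]" =>
  (Matrix.of fun (i j : Fin 2 × (Fin 3 → ZMod L) × Fin N × Fin 2) =>
    if i.1 = j.1 ∧ j.2.1 = i.2.1 + Pi.single k 1 ∧ i.2.2.2 = j.2.2.2 then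
      ρ₀ (W ((Fin.cons (τ i.1) i.2.1 : TorusSite 4 L), Fin.succ k)) i.2.2.1 j.2.2.1 else 0)

set_option quotPrecheck false in
/-- The block of `D'[W]` on the planes `τ c` with spin blocks `σf c`. -/
local notation "planeBlock[" W ", " m ", " τ ", " σf "]" =>
  (Matrix.of fun (i j : Fin 2 × (Fin 3 → ZMod L) × Fin N × Fin 2) =>
    rotD[ρ₀, W, m] ((Fin.cons (τ i.1) i.2.1 : TorusSite 4 L), i.2.2.1, spin4[σf i.1, i.2.2.2])
      ((Fin.cons (τ j.1) j.2.1 : TorusSite 4 L), j.2.2.1, spin4[σf j.1, j.2.2.2]))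

section Plane

/-- The hops are isometries: `H_kᴴ H_k = 1`. -/
theorem planeHop_conjTranspose_mul_self (W : GaugeConfig 4 L 𝕌) (τ : Fin 2 → ZMod L) (k : Fin 3) :
    (planeHop[W, τ, k])ᴴ * planeHop[W, τ, k] = 1 := by
  ext ⟨c, xs, a, s⟩ ⟨c', ys, b, s'⟩
  rw [Matrix.mul_apply, Matrix.one_apply]
  have key : ∀ i : Fin 2 × (Fin 3 → ZMod L) × Fin N × Fin 2,
      (planeHop[W, τ, k])ᴴ (c, xs, a, s) i * (planeHop[W, τ, k]) i (c', ys, b, s') =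
        if i.1 = c ∧ xs = i.2.1 + Pi.single k 1 ∧ i.2.2.2 = s then
          (if i.1 = c' ∧ ys = i.2.1 + Pi.single k 1 ∧ i.2.2.2 = s' then
            star (ρ₀ (W ((Fin.cons (τ i.1) i.2.1 : TorusSite 4 L), Fin.succ k)) i.2.2.1 a) *
              ρ₀ (W ((Fin.cons (τ i.1) i.2.1 : TorusSite 4 L), Fin.succ k)) i.2.2.1 b
          else 0)
        else 0 := by
    intro i
    simp only [Matrix.conjTranspose_apply, Matrix.of_apply]
    split_ifs <;> simp
  simp_rw [key]
  rw [Finset.sum_ite, Finset.sum_const_zero, add_zero]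
  have hfilter : (Finset.univ.filter fun i : Fin 2 × (Fin 3 → ZMod L) × Fin N × Fin 2 =>
      i.1 = c ∧ xs = i.2.1 + Pi.single k 1 ∧ i.2.2.2 = s) =
      Finset.univ.image fun e : Fin N => (c, xs - Pi.single k 1, e, s) := by
    ext ⟨d, zs, e, u⟩
    simp only [Finset.mem_filter, Finset.mem_univ, true_and, Finset.mem_image, Prod.mk.injEq]
    constructor
    · rintro ⟨h1, h2, h3⟩
      exact ⟨e, h1.symm, by rw [h2, add_sub_cancel_right], rfl, h3.symm⟩
    · rintro ⟨e', h1, h2, h3, h4⟩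
      exact ⟨h1.symm, by rw [← h2, sub_add_cancel], h4.symm⟩
  rw [hfilter, Finset.sum_image (fun e _ e' _ h => by simpa using h)]
  simp only [sub_add_cancel]
  by_cases h : c = c' ∧ ys = xs ∧ s = s'
  · obtain ⟨h1, h2, h3⟩ := h
    simp only [← h1, h2, ← h3, and_self, if_true, Prod.mk.injEq, true_and, and_true]
    have hU := Matrix.mem_unitaryGroup_iff'.1
      (W ((Fin.cons (τ c) (xs - Pi.single k 1) : TorusSite 4 L), Fin.succ k)).2
    have := congrFun (congrFun hU a) b
    rw [Matrix.mul_apply, Matrix.one_apply] at this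
    simpa [unitaryFundamentalRep_apply, Matrix.star_apply] using this
  · rw [if_neg]
    · have h' : ¬(c = c' ∧ ys = xs ∧ s = s') := h
      simp only [h', if_false, Finset.sum_const_zero]
    · rintro ⟨rfl, rfl, rfl, rfl⟩; exact h ⟨rfl, rfl, rfl⟩


/-- Elementary rearrangement used entrywise. -/
private theorem ite_ite_mul_aux (P Q : Prop) [Decidable P] [Decidable Q] (x : ℂ) :
    (if P then (if Q then -(1 / 2 : ℂ) else 0) * x else 0) = -(1 / 2 : ℂ) * (if P ∧ Q then x else 0) := by
  by_cases hP : P <;> by_cases hQ : Q <;> simp [hP, hQ]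

omit [NeZero L] in
/-- **The plane blocks are the spin-blind spatial Wilson operator**:
`planeBlock = (m+4)·1 - ½ Σ_k (H_k + H_kᴴ)` (Montvay–Münster (4.104)–(4.105), colour-gauged), provided
the two plane times are different and not adjacent. -/
theorem planeBlock_eq (W : GaugeConfig 4 L 𝕌) (m : ℝ) (τ : Fin 2 → ZMod L) (σf : Fin 2 → Fin 2)
    (hτ : ∀ i j : Fin 2, i ≠ j → τ i ≠ τ j) (hτ1 : ∀ i j : Fin 2, τ j ≠ τ i + 1) :
    planeBlock[W, m, τ, σf] =
      ((m + 4 : ℝ) : ℂ) • (1 : Matrix (Fin 2 × (Fin 3 → ZMod L) × Fin N × Fin 2) _ ℂ) -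
        (1 / 2 : ℂ) • ∑ k : Fin 3, (planeHop[W, τ, k] + (planeHop[W, τ, k])ᴴ) := by
  ext ⟨c, xs, a, s⟩ ⟨c', ys, b, s'⟩
  rw [Matrix.of_apply]
  dsimp only
  conv_rhs => simp only [Matrix.sub_apply, Matrix.smul_apply, Matrix.one_apply, Matrix.sum_apply,
    Matrix.add_apply, Matrix.conjTranspose_apply, Matrix.of_apply, smul_eq_mul, Prod.mk.injEq]
  by_cases hcc : c = c'
  · subst hcc
    rw [rotD_apply_cons]
    rw [if_neg (show ¬(τ c = τ c + 1 ∧ ys = xs) from fun h => hτ1 c c h.1),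
      if_neg (show ¬(τ c = τ c + 1 ∧ xs = ys) from fun h => hτ1 c c h.1), add_zero, zero_add]
    have hspin : ((spin4[σf c, s]) = spin4[σf c, s']) = (s = s') :=
      propext ⟨fun h => (spin4_inj h).2, fun h => by rw [h]⟩
    have hs : (s' = s) = (s = s') := propext eq_comm
    simp only [true_and, rotF_spin4_same (Fin.succ_ne_zero _), rotG_spin4_same (Fin.succ_ne_zero _),
      apply_ite (star : ℂ → ℂ), star_zero, star_rep_apply, ite_ite_mul_aux, mul_ite, mul_one, mul_zero,
      hspin, hs]
    rw [Finset.mul_sum, sub_eq_add_neg, ← Finset.sum_neg_distrib]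
    congr 1
    refine Finset.sum_congr rfl fun k _ => ?_
    split_ifs <;> ring
  · rw [rotD_cons_eq_zero _ _ _ _ _ _ _ _ _ _ _ _ _ (hτ c c' hcc) (fun h => absurd h (hτ1 c c'))
      (fun h => absurd h (hτ1 c' c))]
    have hcc' : ¬(c' = c) := fun h => hcc h.symm
    simp [hcc, hcc']

/-- `star x ⬝ᵥ x` is the squared Euclidean norm. -/
private theorem re_star_dotProduct_self {ι : Type*} [Fintype ι] (x : ι → ℂ) :
    (star x ⬝ᵥ x).re = ‖(WithLp.toLp 2 x : EuclideanSpace ℂ ι)‖ ^ 2 := by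
  rw [← @inner_self_eq_norm_sq ℂ, EuclideanSpace.inner_eq_star_dotProduct, dotProduct_comm]
  rfl

/-- Cauchy–Schwarz for `star x ⬝ᵥ (H x)` with `H` an isometry: `|Re| ≤ ‖x‖²`. -/
private theorem abs_re_star_dotProduct_mulVec_le {ι : Type*} [Fintype ι] [DecidableEq ι] (H : Matrix ι ι ℂ)
    (hH : Hᴴ * H = 1) (x : ι → ℂ) :
    |(star x ⬝ᵥ (H *ᵥ x)).re| ≤ ‖(WithLp.toLp 2 x : EuclideanSpace ℂ ι)‖ ^ 2 := by
  set X : EuclideanSpace ℂ ι := WithLp.toLp 2 x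
  set Y : EuclideanSpace ℂ ι := WithLp.toLp 2 (H *ᵥ x)
  have h1 : star x ⬝ᵥ (H *ᵥ x) = @inner ℂ _ _ X Y := by
    rw [EuclideanSpace.inner_eq_star_dotProduct, dotProduct_comm]
  have hY : ‖Y‖ = ‖X‖ := by
    have h2 : ‖Y‖ ^ 2 = ‖X‖ ^ 2 := by
      rw [← re_star_dotProduct_self, ← re_star_dotProduct_self]
      rw [star_mulVec, ← dotProduct_mulVec, mulVec_mulVec, hH, one_mulVec]
    exact (sq_eq_sq₀ (norm_nonneg _) (norm_nonneg _)).1 h2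
  rw [h1]
  have h3 := norm_inner_le_norm (𝕜 := ℂ) X Y
  rw [hY, ← sq] at h3
  exact (Complex.abs_re_le_norm (@inner ℂ _ _ X Y)).trans h3

/-- **Positivity of the plane blocks** (Montvay–Münster (4.111): `B > 0` for `6κ < 1`, i.e. `m > -1`):
`Re ⟨x, B x⟩ ≥ (m + 1)‖x‖²`, so the direct sum of the two hyperplane blocks of `D'[W]` is positive
definite for every `U(N)` background once `m > -1`. -/
theorem planeBlock_posDef (W : GaugeConfig 4 L 𝕌) (m : ℝ) (τ : Fin 2 → ZMod L) (σf : Fin 2 → Fin 2)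
    (hτ : ∀ i j : Fin 2, i ≠ j → τ i ≠ τ j) (hτ1 : ∀ i j : Fin 2, τ j ≠ τ i + 1) (hm : -1 < m) :
    (planeBlock[W, m, τ, σf]).PosDef := by
  rw [planeBlock_eq W m τ σf hτ hτ1]
  set H : Fin 3 → Matrix (Fin 2 × (Fin 3 → ZMod L) × Fin N × Fin 2) (Fin 2 × (Fin 3 → ZMod L) × Fin N × Fin 2) ℂ :=
    fun k => planeHop[W, τ, k] with hH
  have hiso : ∀ k, (H k)ᴴ * H k = 1 := fun k => planeHop_conjTranspose_mul_self W τ k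
  have hiso' : ∀ k, H k * (H k)ᴴ = 1 := fun k => mul_eq_one_comm.1 (hiso k)
  change (((m + 4 : ℝ) : ℂ) • (1 : Matrix _ _ ℂ) - (1 / 2 : ℂ) • ∑ k : Fin 3, (H k + (H k)ᴴ)).PosDef
  have hHerm : (((m + 4 : ℝ) : ℂ) • (1 : Matrix (Fin 2 × (Fin 3 → ZMod L) × Fin N × Fin 2) _ ℂ) -
      (1 / 2 : ℂ) • ∑ k : Fin 3, (H k + (H k)ᴴ)).IsHermitian := by
    refine (isHermitian_one.smul (Complex.conj_ofReal _)).sub (IsHermitian.smul ?_ (by norm_num [IsSelfAdjoint]))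
    unfold Matrix.IsHermitian
    rw [conjTranspose_sum]
    refine Finset.sum_congr rfl fun k _ => ?_
    rw [conjTranspose_add, conjTranspose_conjTranspose, add_comm]
  refine Matrix.posDef_iff_dotProduct_mulVec.2 ⟨hHerm, fun x hx => ?_⟩
  have him := hHerm.im_star_dotProduct_mulVec_self x
  -- the quadratic form
  have hq : star x ⬝ᵥ ((((m + 4 : ℝ) : ℂ) • (1 : Matrix _ _ ℂ) - (1 / 2 : ℂ) • ∑ k : Fin 3, (H k + (H k)ᴴ)) *ᵥ x) =
      ((m + 4 : ℝ) : ℂ) * (star x ⬝ᵥ x) -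
        (1 / 2 : ℂ) * ∑ k : Fin 3, (star x ⬝ᵥ (H k *ᵥ x) + star x ⬝ᵥ ((H k)ᴴ *ᵥ x)) := by
    rw [sub_mulVec, smul_mulVec, one_mulVec, smul_mulVec, sum_mulVec, dotProduct_sub,
      dotProduct_smul, dotProduct_smul, dotProduct_sum, smul_eq_mul, smul_eq_mul]
    congr 2
    refine Finset.sum_congr rfl fun k _ => ?_
    rw [add_mulVec, dotProduct_add]
  set X : EuclideanSpace ℂ (Fin 2 × (Fin 3 → ZMod L) × Fin N × Fin 2) := WithLp.toLp 2 x with hX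
  have hXpos : 0 < ‖X‖ ^ 2 := by
    have : X ≠ 0 := fun h => hx (by simpa [hX] using congrArg WithLp.ofLp h)
    positivity
  have hre : (m + 1) * ‖X‖ ^ 2 ≤ (star x ⬝ᵥ ((((m + 4 : ℝ) : ℂ) • (1 : Matrix _ _ ℂ) -
      (1 / 2 : ℂ) • ∑ k : Fin 3, (H k + (H k)ᴴ)) *ᵥ x)).re := by
    rw [hq, Complex.sub_re, Complex.mul_re, Complex.ofReal_re, Complex.ofReal_im, zero_mul, sub_zero,
      re_star_dotProduct_self, ← hX, Complex.mul_re, Complex.re_sum]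
    simp only [Complex.add_re, one_div, Complex.inv_re, Complex.inv_im, Complex.re_ofNat, Complex.im_ofNat,
      Complex.normSq_ofNat, Complex.im_sum, neg_zero, zero_div, zero_mul, sub_zero]
    have hb : ∀ k, (star x ⬝ᵥ (H k *ᵥ x)).re + (star x ⬝ᵥ ((H k)ᴴ *ᵥ x)).re ≤ ‖X‖ ^ 2 + ‖X‖ ^ 2 :=
      fun k => add_le_add (le_of_abs_le (abs_re_star_dotProduct_mulVec_le (H k) (hiso k) x))
        (le_of_abs_le (abs_re_star_dotProduct_mulVec_le ((H k)ᴴ)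
          (by rw [conjTranspose_conjTranspose]; exact hiso' k) x))
    have hsum := Finset.sum_le_sum fun k (_ : k ∈ (Finset.univ : Finset (Fin 3))) => hb k
    simp only [Finset.sum_const, Finset.card_univ, Fintype.card_fin, nsmul_eq_mul, Nat.cast_ofNat] at hsum
    nlinarith [hsum, hXpos]
  rw [Complex.lt_def]
  rw [RCLike.im_to_complex] at him
  refine ⟨?_, by rw [Complex.zero_im, him]⟩
  rw [Complex.zero_re]
  have : 0 < (m + 1) * ‖X‖ ^ 2 := mul_pos (by linarith) hXpos
  linarith


omit [NeZero L] in
/-- The plane blocks only depend on the spatial links inside the two planes. -/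
theorem planeBlock_congr (W W' : GaugeConfig 4 L 𝕌) (m : ℝ) (τ : Fin 2 → ZMod L) (σf : Fin 2 → Fin 2)
    (hτ : ∀ i j : Fin 2, i ≠ j → τ i ≠ τ j) (hτ1 : ∀ i j : Fin 2, τ j ≠ τ i + 1)
    (hW : ∀ (c : Fin 2) (xs : Fin 3 → ZMod L) (k : Fin 3),
      W ((Fin.cons (τ c) xs : TorusSite 4 L), k.succ) = W' ((Fin.cons (τ c) xs : TorusSite 4 L), k.succ)) :
    planeBlock[W, m, τ, σf] = planeBlock[W', m, τ, σf] := by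
  rw [planeBlock_eq W m τ σf hτ hτ1, planeBlock_eq W' m τ σf hτ hτ1]
  congr 2
  refine Finset.sum_congr rfl fun k _ => ?_
  have : planeHop[W, τ, k] = planeHop[W', τ, k] := by
    ext i j
    simp only [Matrix.of_apply, hW]
  rw [this]

end Plane

end Summit.QuantumFields.QCD.Theorems.BackgroundSchwarz
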